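import Literature.Analysis.FluidPDE.NSSereginBlowupCore
import Literature.Analysis.FluidPDE.NormalisedPressureSliceMeasurabilityLp
import Literature.Analysis.FluidPDE.NormalisedPressureLpClass
import Literature.Analysis.FluidPDE.NormalisedPressureAxisymmetric
import Literature.Analysis.FluidPDE.SereginSverakBlowupSelection
import Literature.Analysis.FluidPDE.LocalEnergyTimeShift
import Literature.Analysis.FluidPDE.ClassicalSuitable
import HarnessLib

/-!
# Stub `stub_katoLocalEnergyNearTop` of the line `registered`
# (crux `AxisymmetricKatoGlobal`, stmt-NavierStokesRegularity-15453, route `AxisymmetricExtremality`)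

**Stub K (reshape v3): the local energy classes of a smooth axisymmetric Kato solution reach the
final time** — the Calderón / Rusin–Šverák splitting of a Kato solution UP TO THE FINAL TIME
(W. Rusin, V. Šverák, J. Funct. Anal. 260 (2011) = arXiv:0911.0500, §4 p. 6: "the equation for
`v`, together with the local energy inequality, implies that `v` is in the energy class up to the
blow-up time"; C. P. Calderón, Trans. AMS 318 (1990), §1; P. G. Lemarié-Rieusset, *The
Navier–Stokes problem in the 21st century* (2016), Prop. 15.1, Thm. 15.1).

For a Kato solution `u` on `[0, T)` (`IsKatoSolutionOn T ν u₀ u`), smooth on `(0, T) × ℝ³` with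
axisymmetric slices, the pressure is the POINTWISE normalised pressure `p(t) = p̃[u(t)]`
(`normalisedPressure`; axisymmetric by `IsAxisymmetric.isAxisymmetricScalar_normalisedPressure`);
helpers in the namespace `….Registered.KatoNearTop`:
* PRESSURE — `p` is jointly measurable on strips with `∫∫|p|^{3/2} ≤ C^{3/2}∫∫|u|³`
  (`aestronglyMeasurable_normalisedPressure_slab`, `lintegral_slab_normalisedPressure_rpow_le`);
  the weak pressure Poisson equation (`integral_normalisedPressure_mul_laplacian_of_memLp`) makes
  `(u, p)` suitable on every interior slab (`IsKatoSolutionOn.distributional_slab_of_pressure`,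
  `.suitable_slab_of_pressure`), hence on the open strip `(0, T) × ℝ³` by exhaustion
  (`IsSuitableWeakSolutionOn.of_exhaustion`); after a bounded slice `u(s)` the solution is in
  `L³((s, T) × ℝ³)` (`IsKatoSolutionOn.restart`, `.lintegral_enorm_cube_lt_top_of_ae_bounded`).
* ENERGY — for a Kato solution `v` with BOUNDED datum, smooth inside, the energy bound of the
  caloric remainder `v - e^{νtΔ}v₀` (`caloric_remainder_energy_bound` on every interior slab with
  the suitable structure of `IsKatoSolutionOn.exists_rieszPressure_suitable_slab`; constant
  monotone in the slab, `energyConst_mono`; the weak gradient is the classical one a.e.,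
  `hasWeakSpatialGradientOn_of_contDiffOn`, `HasWeakSpatialGradientOn.ae_eq`) holds up to `T`
  (`energy_dissipation_bound`); with `|e^{νtΔ}v₀| ≤ M` and `|∇e^{νtΔ}v₀| ≤ 2^{3/2}(νδ)^{-1/2}M`
  (`norm_heatFlow_le_of_bound`, `norm_fderiv_heatFlow_le_of_bound`) the local classes follow
  (`local_energy_bounds`).
* THE STUB — restart at the slice `u(t₁/2)` (bounded: `IsKatoSolutionOn.exists_ae_norm_le_of_pos`,
  everywhere by continuity) and translate back in time (`setLIntegral_prod_timeShift`); the
  `Sₙ ↑ T` bookkeeping is adapted from the tree's `KatoRemainderL3.lean`, `NSSereginBlowupCore.lean`.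
-/

noncomputable section

-- the summit and its single problem share the name (D-0017 nested layout)
set_option linter.dupNamespace false

open Set MeasureTheory Filter Topology Function Metric
open scoped ENNReal NNReal Laplacian
open Literature.Analysis.FluidPDE Literature.Analysis.FunctionSpaces

namespace Summit.NavierStokesRegularity.NavierStokesRegularity.Theorems.AxisymmetricKatoGlobal.Registered

/-- Local notation for physical space `ℝ³` (as in the registered skeleton). -/
local notation "ℝ³" => EuclideanSpace ℝ (Fin 3)

namespace KatoNearTop

variable {T ν : ℝ} {u₀ : ℝ³ → ℝ³} {u : ℝ → ℝ³ → ℝ³}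

/-- Every slice `u t`, `0 ≤ t < T`, of a Kato solution lies in `L^{2·(3/2)} = L³`. -/
theorem memLp_two_mul_threeHalves (hu : IsKatoSolutionOn T ν u₀ u) {t : ℝ} (ht : t ∈ Ico 0 T) :
    MemLp (u t) (2 * (3 / 2 : ℝ≥0∞)) volume := by
  rw [show (2 : ℝ≥0∞) * (3 / 2) = 3 by rw [ENNReal.mul_div_cancel (by norm_num) (by norm_num)]]
  exact hu.memLp ht

/-- `|u(t)|² ∈ L^{3/2}` for a.e. (indeed every) `t` of a time interval `(a, b)`, `0 ≤ a`, `b ≤ T`. -/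
theorem ae_memLp_norm_sq (hu : IsKatoSolutionOn T ν u₀ u) {a b : ℝ} (ha : 0 ≤ a) (hb : b ≤ T) :
    ∀ᵐ t ∂(volume.restrict (Ioo a b)), MemLp (fun y => ‖u t y‖ ^ 2) (3 / 2 : ℝ≥0∞) volume := by
  filter_upwards [ae_restrict_mem measurableSet_Ioo] with t ht
  exact memLp_norm_sq_of_memLp_two_mul (memLp_two_mul_threeHalves hu ⟨ha.trans ht.1.le, ht.2.trans_le hb⟩)

/-- A Kato solution is jointly measurable on every strip `(a, b) × ℝ³`, `0 ≤ a`, `b ≤ T`. -/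
theorem aestronglyMeasurable_strip (hu : IsKatoSolutionOn T ν u₀ u) {a b : ℝ} (ha : 0 ≤ a) (hb : b ≤ T) :
    AEStronglyMeasurable (uncurry u) (volume.restrict (Ioo a b ×ˢ (univ : Set ℝ³))) :=
  hu.aestronglyMeasurable.mono_measure (Measure.restrict_mono (prod_mono (Ioo_subset_Ioo ha hb) Subset.rfl) le_rfl)

/-- **Joint measurability of the pointwise normalised pressure of a Kato solution** on every strip
`(a, b) × ℝ³`, `0 ≤ a`, `b ≤ T` (`aestronglyMeasurable_normalisedPressure_slab`, class `|u(t)|² ∈ L^{3/2}`). -/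
theorem aestronglyMeasurable_normalisedPressure_strip (hu : IsKatoSolutionOn T ν u₀ u) {a b : ℝ}
    (ha : 0 ≤ a) (hb : b ≤ T) :
    AEStronglyMeasurable (fun z : ℝ × ℝ³ => normalisedPressure (u z.1) z.2)
      (volume.restrict (Ioo a b ×ˢ (univ : Set ℝ³))) := by
  have hp1 : (1 : ℝ≥0∞) < 3 / 2 :=
    (ENNReal.lt_div_iff_mul_lt (Or.inl (by norm_num)) (Or.inl (by norm_num))).2 (by norm_num)
  exact aestronglyMeasurable_normalisedPressure_slab hp1 (ENNReal.div_lt_top (by norm_num) (by norm_num))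
    (aestronglyMeasurable_strip hu ha hb) (ae_memLp_norm_sq hu ha hb)

/-- **Stein's bound integrated in time**: on a strip `(a, b) × ℝ³`, `0 ≤ a`, `b ≤ T`, where the Kato
solution is in `L³`, `∫∫ |p̃[u]|^{3/2} ≤ C^{3/2} ∫∫ |u|³ < ∞` (`lintegral_slab_normalisedPressure_rpow_le`). -/
theorem lintegral_normalisedPressure_strip_lt_top (hu : IsKatoSolutionOn T ν u₀ u) {a b : ℝ}
    (ha : 0 ≤ a) (hb : b ≤ T) (h3 : ∫⁻ z in Ioo a b ×ˢ (univ : Set ℝ³), ‖u z.1 z.2‖ₑ ^ (3 : ℝ) < ∞) :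
    ∫⁻ z in Ioo a b ×ˢ (univ : Set ℝ³), ‖normalisedPressure (u z.1) z.2‖ₑ ^ (3 / 2 : ℝ) < ∞ := by
  have hp1 : (1 : ℝ≥0∞) < 3 / 2 :=
    (ENNReal.lt_div_iff_mul_lt (Or.inl (by norm_num)) (Or.inl (by norm_num))).2 (by norm_num)
  obtain ⟨C, hC⟩ := lintegral_slab_normalisedPressure_rpow_le hp1 (ENNReal.div_lt_top (by norm_num) (by norm_num))
  have h := hC (Ioo a b) u (aestronglyMeasurable_strip hu ha hb) (ae_memLp_norm_sq hu ha hb)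
  rw [ennreal_toReal_three_halves, show 2 * (3 / 2 : ℝ) = 3 by norm_num] at h
  exact h.trans_lt (ENNReal.mul_lt_top (ENNReal.rpow_lt_top_of_nonneg (by norm_num) ENNReal.coe_ne_top) h3)

/-- **`(u, p̃[u])` is a suitable weak solution on every interior slab** `(0, S) × ℝ³`, `0 < S < T`:
the weak pressure Poisson equation of `p̃[u(t)]`, `u(t) ∈ L³`, makes `(u, p̃[u])` distributional on
the slab (`IsKatoSolutionOn.distributional_slab_of_pressure`), and suitability follows from
`IsKatoSolutionOn.suitable_slab_of_pressure` (Lemarié-Rieusset 2016, Thm. 15.1 (A)). -/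
theorem suitable_normalisedPressure_slab (hν : 0 < ν) (hu : IsKatoSolutionOn T ν u₀ u) {S : ℝ}
    (hS : 0 < S) (hST : S < T) :
    IsSuitableWeakSolutionOn (slab ℝ³ (Ioo 0 S) isOpen_Ioo) ν 0 u (fun t => normalisedPressure (u t)) := by
  have hp1 : (1 : ℝ≥0∞) < 3 / 2 :=
    (ENNReal.lt_div_iff_mul_lt (Or.inl (by norm_num)) (Or.inl (by norm_num))).2 (by norm_num)
  have hp2 : (3 / 2 : ℝ≥0∞) < ⊤ := ENNReal.div_lt_top (by norm_num) (by norm_num)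
  have hpm := aestronglyMeasurable_normalisedPressure_strip hu le_rfl hST.le
  have hpS := lintegral_normalisedPressure_strip_lt_top hu le_rfl hST.le
    (hu.lintegral_strip_enorm_rpow_three_lt_top hST)
  have hsl : ∀ᵐ t ∂(volume.restrict (Ioo 0 S)), ∀ φ : ℝ³ → ℝ,
      ContDiff ℝ (⊤ : ℕ∞) φ → HasCompactSupport φ → ∫ x, (fun t => normalisedPressure (u t)) t x * (Δ φ) x =
        -∫ x, fderiv ℝ (fderiv ℝ φ) x (u t x) (u t x) := by
    filter_upwards [ae_restrict_mem measurableSet_Ioo] with t ht φ hφ hφc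
    exact integral_normalisedPressure_mul_laplacian_of_memLp hp1 hp2
      (memLp_two_mul_threeHalves hu ⟨ht.1.le, ht.2.trans hST⟩) hφ hφc
  exact hu.suitable_slab_of_pressure hν hS hST
    (hu.distributional_slab_of_pressure hν hST (memLp_threeHalves_of_lintegral_rpow_lt_top hpm hpS) hsl) hpS

/-- The exhausting times `Sₙ = T(n+1)/(n+2)` of `[0, T)`: positive, below `T`, nondecreasing. -/
theorem seq_facts (hT : 0 < T) :
    (∀ n : ℕ, 0 < T * (((n : ℝ) + 1) / ((n : ℝ) + 2))) ∧ (∀ n : ℕ, T * (((n : ℝ) + 1) / ((n : ℝ) + 2)) < T) ∧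
      Monotone fun n : ℕ => T * (((n : ℝ) + 1) / ((n : ℝ) + 2)) := by
  refine ⟨fun n => by positivity, fun n => ?_, fun m n hmn => ?_⟩
  · have : ((n : ℝ) + 1) / ((n : ℝ) + 2) < 1 := by rw [div_lt_one (by positivity)]; linarith
    nlinarith
  · dsimp only
    refine mul_le_mul_of_nonneg_left ?_ hT.le
    rw [div_le_div_iff₀ (by positivity) (by positivity)]
    nlinarith [(Nat.cast_le.2 hmn : (m : ℝ) ≤ n)]

/-- **`(u, p̃[u])` is a suitable weak solution on the whole open strip `(0, T) × ℝ³`** (nothing is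
assumed at `t = T`, which may be the blow-up time): suitability is local, and every compact subset
of the strip lies in a slab `(0, Sₙ) × ℝ³` (`exists_subslab_of_isCompact`, `IsSuitableWeakSolutionOn.of_exhaustion`). -/
theorem suitable_normalisedPressure_strip (hν : 0 < ν) (hu : IsKatoSolutionOn T ν u₀ u) (hT : 0 < T) :
    IsSuitableWeakSolutionOn (slab ℝ³ (Ioo 0 T) isOpen_Ioo) ν 0 u (fun t => normalisedPressure (u t)) := by
  obtain ⟨hS0, hST, hSmono⟩ := seq_facts hT
  exact IsSuitableWeakSolutionOn.of_exhaustion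
    (Qn := fun n => slab ℝ³ (Ioo 0 (T * (((n : ℝ) + 1) / ((n : ℝ) + 2)))) isOpen_Ioo)
    (fun n => slab_mono (Ioo_subset_Ioo_right (hST n).le))
    (fun m n hmn => slab_mono (Ioo_subset_Ioo_right (hSmono hmn)))
    (fun K hK hKc => exists_subslab_of_isCompact hK hKc) (fun n => suitable_normalisedPressure_slab hν hu (hS0 n) (hST n))

/-- **`L³` up to the final time after a bounded slice** `u(s)`, `0 < s < T` (Rusin–Šverák 2011, §4
p. 6): `∫_{s}^{T}∫ |u|³ < ∞` — restart at `s` (`IsKatoSolutionOn.restart`) and translate in time. -/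
theorem lintegral_enorm_cube_lt_top_of_bounded_slice (hν : 0 < ν) (hu : IsKatoSolutionOn T ν u₀ u)
    {s M : ℝ} (hs : s ∈ Ioo 0 T) (hMb : ∀ x, ‖u s x‖ ≤ M) :
    ∫⁻ z in Ioo s T ×ˢ (univ : Set ℝ³), ‖u z.1 z.2‖ₑ ^ (3 : ℝ) < ∞ := by
  have h := (hu.restart hν ⟨hs.1.le, hs.2⟩).lintegral_enorm_cube_lt_top_of_ae_bounded hν (by linarith [hs.2])
    (Eventually.of_forall hMb)
  have e := setLIntegral_prod_timeShift s s T (univ : Set ℝ³) (fun z : ℝ × ℝ³ => ‖u z.1 z.2‖ₑ ^ (3 : ℝ))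
  rw [sub_self] at e
  rw [← e]; exact h

/-- **The pressure class reaches the final time**: with a bounded slice `u(s)`, `0 < s < T`,
`∫_{s}^{T}∫ |p̃[u]|^{3/2} < ∞`. -/
theorem lintegral_normalisedPressure_lt_top_of_bounded_slice (hν : 0 < ν)
    (hu : IsKatoSolutionOn T ν u₀ u) {s M : ℝ} (hs : s ∈ Ioo 0 T) (hMb : ∀ x, ‖u s x‖ ≤ M) :
    ∫⁻ z in Ioo s T ×ˢ (univ : Set ℝ³), ‖normalisedPressure (u z.1) z.2‖ₑ ^ (3 / 2 : ℝ) < ∞ :=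
  lintegral_normalisedPressure_strip_lt_top hu hs.1.le le_rfl (lintegral_enorm_cube_lt_top_of_bounded_slice hν hu hs hMb)

/-- **Energy and dissipation of the caloric remainder up to the final time** (Rusin–Šverák 2011,
§4 p. 6: "`v` is in the energy class up to the blow-up time"; Lemarié-Rieusset 2016, Prop. 15.1):
for a Kato solution `v` on `[0, T)`, smooth on `(0, T) × ℝ³`, with bounded datum `|v₀| ≤ M`, there is
`K ≥ 0` with `∫ |v(t) - e^{νtΔ}v₀|² ≤ K` for EVERY `0 < t < T` and
`∫₀ᵀ∫ |∇v - ∇e^{νtΔ}v₀|² ≤ K/ν`. -/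
theorem energy_dissipation_bound {v₀ : ℝ³ → ℝ³} {v : ℝ → ℝ³ → ℝ³} (hν : 0 < ν)
    (hv : IsKatoSolutionOn T ν v₀ v)
    (hT : 0 < T) {M : ℝ} (hM0 : 0 ≤ M) (hMb : ∀ x, ‖v₀ x‖ ≤ M) (hsm : IsSmoothSpaceTimeOn (Ioo 0 T) v) :
    ∃ K : ℝ, 0 ≤ K ∧ (∀ t ∈ Ioo 0 T, ∫⁻ x, ‖v t x - heatFlow v₀ (ν * t) x‖ₑ ^ 2 ≤ ENNReal.ofReal K) ∧
      ∫⁻ z in Ioo 0 T ×ˢ (univ : Set ℝ³), ENNReal.ofReal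
          (frobeniusNormSq (fderiv ℝ (v z.1) z.2 - fderiv ℝ (heatFlow v₀ (ν * z.1)) z.2)) ≤ ENNReal.ofReal (K / ν) := by
  have hv₀3 : MemLp v₀ 3 volume := hv.memLp_initial hT
  have hN30 : 0 ≤ ∫ x, ‖v₀ x‖ ^ 3 := integral_nonneg fun _ => by positivity
  set Kst : ℝ := ((M * (∫ x, ‖v₀ x‖ ^ 3) * T / ν) *
    (1 + (2 * (2 ^ ((3 : ℝ) / 2) * ν ^ (-(1 / 2 : ℝ)) * M) * (2 * T ^ ((1 : ℝ) / 2)))) *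
    Real.exp ((2 * (2 ^ ((3 : ℝ) / 2) * ν ^ (-(1 / 2 : ℝ)) * M) * (2 * T ^ ((1 : ℝ) / 2)))))
  have h1smooth : ContDiffOn ℝ 1 (uncurry v) (Ioo 0 T ×ˢ univ) := hsm.of_le (by exact_mod_cast le_top)
  -- ### the bound at every time `t < T`, on the slab `(0, S)`, `S = (t + T)/2`
  have hEB : ∀ t ∈ Ioo 0 T, (∫⁻ x, ‖v t x - heatFlow v₀ (ν * t) x‖ₑ ^ 2) ≤ ENNReal.ofReal Kst ∧
      ENNReal.ofReal ν * ∫⁻ z in Ioc 0 t ×ˢ (univ : Set ℝ³), ENNReal.ofReal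
        (frobeniusNormSq (fderiv ℝ (v z.1) z.2 - fderiv ℝ (heatFlow v₀ (ν * z.1)) z.2)) ≤ ENNReal.ofReal Kst := by
    intro t ht
    set S : ℝ := (t + T) / 2 with hS
    have hS0 : 0 < S := by rw [hS]; linarith [ht.1, ht.2]
    have hST : S < T := by rw [hS]; linarith [ht.2]
    have htS : t < S := by rw [hS]; linarith [ht.2]
    obtain ⟨p, -, hp32, -, -, hsuit⟩ := hv.exists_rieszPressure_suitable_slab hν hS0 hST
    obtain ⟨G, hG, hG2, hLEI⟩ := hsuit.localEnergy
    have hKS := energyConst_mono (N := ∫ x, ‖v₀ x‖ ^ 3) hν hM0 hN30 hS0.le hST.le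
    obtain ⟨h1, h2⟩ := caloric_remainder_energy_bound hν hS0 hM0 hMb hv₀3 (hv.isWeaklyDivFree_initial hT)
      hsuit.distributional hG hG2 hLEI (hv.memLp_three_strip hST) hp32
      (hv.continuousInLpOn.mono (Ico_subset_Ico_right hST.le)) hv.initial ⟨ht.1, htS⟩
    refine ⟨h1.trans (ENNReal.ofReal_le_ofReal hKS), le_trans (le_of_eq ?_) (h2.trans (ENNReal.ofReal_le_ofReal hKS))⟩
    -- the weak gradient of the suitable structure is the classical gradient a.e.
    have hG' : HasWeakSpatialGradientOn (slab ℝ³ (Ioo 0 S) isOpen_Ioo) v fun t x => fderiv ℝ (v t) x :=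
      hasWeakSpatialGradientOn_of_contDiffOn (S := Ioo 0 T) isOpen_Ioo
        (fun z hz => ⟨⟨(mem_slab.1 hz).1, (mem_slab.1 hz).2.trans hST⟩, mem_univ _⟩) h1smooth
    have hsub : Ioc 0 t ×ˢ (univ : Set ℝ³) ⊆ Ioo 0 S ×ˢ univ :=
      prod_mono (Ioc_subset_Ioo_right htS) Subset.rfl
    have hae := ae_restrict_of_ae_restrict_of_subset hsub (hG'.ae_eq hG)
    congr 1
    refine lintegral_congr_ae (hae.mono fun z hz => ?_)
    have hz' : fderiv ℝ (v z.1) z.2 = G z.1 z.2 := hz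
    simp only [hz']
  -- ### the dissipation on the whole strip, `(0, T) × ℝ³ = ⋃ₙ (0, Sₙ] × ℝ³`
  -- (adapted from `IsKatoSolutionOn.lintegral_enorm_cube_lt_top_of_ae_bounded`, `KatoRemainderL3.lean`)
  refine ⟨Kst, by positivity, fun t ht => (hEB t ht).1, ?_⟩
  obtain ⟨hS0, hST, hSmono⟩ := seq_facts hT
  have hdir : Directed (· ⊆ ·) fun n : ℕ => Ioc 0 (T * (((n : ℝ) + 1) / ((n : ℝ) + 2))) ×ˢ (univ : Set ℝ³) :=
    Monotone.directed_le fun m n hmn => prod_mono (Ioc_subset_Ioc_right (hSmono hmn)) Subset.rfl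
  have hU : (⋃ n : ℕ, Ioc 0 (T * (((n : ℝ) + 1) / ((n : ℝ) + 2))) ×ˢ (univ : Set ℝ³)) =
      Ioo 0 T ×ˢ (univ : Set ℝ³) := by
    refine subset_antisymm (iUnion_subset fun n => prod_mono (Ioc_subset_Ioo_right (hST n)) Subset.rfl)
      fun z hz => ?_
    -- `z.1 < Sₙ` for some `n`: the singleton `{z}` is a compact subset of the strip
    obtain ⟨n, hn⟩ := exists_subslab_of_isCompact (S := T) (K := {z})
      (singleton_subset_iff.2 (mem_slab.2 hz.1)) isCompact_singleton
    exact mem_iUnion.2 ⟨n, ⟨hz.1.1, (mem_slab.1 (hn (mem_singleton z))).2.le⟩, hz.2⟩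
  rw [← hU, setLIntegral_iUnion_of_directed _ hdir]
  refine iSup_le fun n => ?_
  rw [ENNReal.ofReal_div_of_pos hν]
  refine (ENNReal.le_div_iff_mul_le (Or.inl (ENNReal.ofReal_pos.2 hν).ne') (Or.inl ENNReal.ofReal_ne_top)).2 ?_
  rw [mul_comm]; exact (hEB _ ⟨hS0 n, hST n⟩).2

/-- **The local energy classes of a Kato solution with bounded datum reach the final time**
(Rusin–Šverák 2011, §4 p. 6; Lemarié-Rieusset 2016, Prop. 15.1): for `v` as above and `δ > 0`,
`sup_{0<t<T} ∫_{B_ρ(0)} |v(t)|² < ∞` and `∫_δ^T∫_{B_ρ(0)} |∇v|² < ∞` (split `v = e + w`: the remainder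
by `energy_dissipation_bound`; `|e| ≤ M` and `|∇e| ≤ 2^{3/2}(νδ)^{-1/2}M` for `t ≥ δ`). -/
theorem local_energy_bounds {v₀ : ℝ³ → ℝ³} {v : ℝ → ℝ³ → ℝ³} (hν : 0 < ν)
    (hv : IsKatoSolutionOn T ν v₀ v)
    (hT : 0 < T) {M : ℝ} (hM0 : 0 ≤ M) (hMb : ∀ x, ‖v₀ x‖ ≤ M) (hsm : IsSmoothSpaceTimeOn (Ioo 0 T) v)
    {δ ρ : ℝ} (hδ : 0 < δ) :
    (∃ C : ℝ≥0, ∀ t ∈ Ioo 0 T, ∫⁻ x in ball (0 : ℝ³) ρ, ‖v t x‖ₑ ^ 2 ≤ C) ∧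
    ∫⁻ z in Ioo δ T ×ˢ ball (0 : ℝ³) ρ,
      ENNReal.ofReal (frobeniusNormSq (fderiv ℝ (v z.1) z.2)) < ∞ := by
  obtain ⟨K, -, hE, hD⟩ := energy_dissipation_bound hν hv hT hM0 hMb hsm
  have hv₀m : AEStronglyMeasurable v₀ volume := (hv.memLp_initial hT).aestronglyMeasurable
  constructor
  · -- ### `sup_t ∫_{B_ρ} |v(t)|² ≤ 2K + 2M²|B_ρ|`
    set Ce : ℝ≥0∞ := 2 * ENNReal.ofReal K + 2 * ENNReal.ofReal M ^ 2 * volume (ball (0 : ℝ³) ρ)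
    have hCetop : Ce ≠ ⊤ := ENNReal.add_ne_top.2 ⟨ENNReal.mul_ne_top (by norm_num) ENNReal.ofReal_ne_top,
      ENNReal.mul_ne_top (ENNReal.mul_ne_top (by norm_num) (ENNReal.pow_ne_top ENNReal.ofReal_ne_top))
        measure_ball_lt_top.ne⟩
    refine ⟨Ce.toNNReal, fun t ht => ?_⟩
    rw [ENNReal.coe_toNNReal hCetop]
    have he : ∀ x, ‖heatFlow v₀ (ν * t) x‖ₑ ^ 2 ≤ ENNReal.ofReal M ^ 2 := fun x => by
      refine pow_le_pow_left' ?_ 2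
      rw [← ofReal_norm]
      exact ENNReal.ofReal_le_ofReal (norm_heatFlow_le_of_bound hMb _ x)
    -- `‖a‖ₑ² ≤ 2‖a - b‖ₑ² + 2‖b‖ₑ²`, pointwise
    have hpt : ∀ x, ‖v t x‖ₑ ^ 2 ≤ 2 * ‖v t x - heatFlow v₀ (ν * t) x‖ₑ ^ 2 + 2 * ENNReal.ofReal M ^ 2 := by
      intro x
      have h1 : ‖v t x‖ₑ ≤ ‖v t x - heatFlow v₀ (ν * t) x‖ₑ + ‖heatFlow v₀ (ν * t) x‖ₑ := by
        calc ‖v t x‖ₑ = ‖(v t x - heatFlow v₀ (ν * t) x) + heatFlow v₀ (ν * t) x‖ₑ := by rw [sub_add_cancel]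
          _ ≤ _ := enorm_add_le _ _
      exact ((pow_le_pow_left' h1 2).trans (Literature.Analysis.FluidPDE.ennreal_add_sq_le _ _)).trans
        (add_le_add le_rfl (mul_le_mul_right (he x) 2))
    calc ∫⁻ x in ball (0 : ℝ³) ρ, ‖v t x‖ₑ ^ 2
        ≤ ∫⁻ x in ball (0 : ℝ³) ρ,
            (2 * ‖v t x - heatFlow v₀ (ν * t) x‖ₑ ^ 2 + 2 * ENNReal.ofReal M ^ 2) := lintegral_mono fun x => hpt x
      _ = 2 * (∫⁻ x in ball (0 : ℝ³) ρ, ‖v t x - heatFlow v₀ (ν * t) x‖ₑ ^ 2) +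
            2 * ENNReal.ofReal M ^ 2 * volume (ball (0 : ℝ³) ρ) := by
          rw [lintegral_add_right _ measurable_const, lintegral_const_mul' _ _ (by norm_num), setLIntegral_const]
      _ ≤ Ce := by
          refine add_le_add (mul_le_mul_right ((lintegral_mono_set (subset_univ _)).trans ?_) 2) le_rfl
          rw [Measure.restrict_univ]
          exact hE t ht
  · -- ### `∫_δ^T ∫_{B_ρ} |∇v|² ≤ 2K/ν + 6 D₁² |(δ,T) × B_ρ|`, `D₁ = 2^{3/2} (νδ)^{-1/2} M`
    set D₁ : ℝ := 2 ^ ((3 : ℝ) / 2) * (ν * δ) ^ (-(1 / 2 : ℝ)) * M with hD₁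
    have hpt : ∀ z : ℝ × ℝ³, δ ≤ z.1 → ENNReal.ofReal (frobeniusNormSq (fderiv ℝ (v z.1) z.2)) ≤
        2 * ENNReal.ofReal (frobeniusNormSq (fderiv ℝ (v z.1) z.2 - fderiv ℝ (heatFlow v₀ (ν * z.1)) z.2)) +
          ENNReal.ofReal (6 * D₁ ^ 2) := by
      intro z hz
      -- the caloric gradient: `|∇e| ≤ D₁`, `|∇e|²_F ≤ 3 D₁²`
      have h := norm_fderiv_heatFlow_le_of_bound hv₀m hMb (mul_pos hν (hδ.trans_le hz)) z.2
      rw [finrank_euclideanSpace_fin] at h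
      have hr : (ν * z.1) ^ (-(1 / 2 : ℝ)) ≤ (ν * δ) ^ (-(1 / 2 : ℝ)) :=
        Real.rpow_le_rpow_of_nonpos (mul_pos hν hδ) (mul_le_mul_of_nonneg_left hz hν.le) (by norm_num)
      have hD : ‖fderiv ℝ (heatFlow v₀ (ν * z.1)) z.2‖ ≤ D₁ := by
        refine h.trans ?_
        rw [hD₁]; push_cast
        exact mul_le_mul_of_nonneg_right (mul_le_mul_of_nonneg_left hr (by positivity)) hM0
      have h2 := frobeniusNormSq_le_finrank_mul_sq_norm (fderiv ℝ (heatFlow v₀ (ν * z.1)) z.2)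
      rw [finrank_euclideanSpace_fin] at h2
      push_cast at h2
      have hDe : frobeniusNormSq (fderiv ℝ (heatFlow v₀ (ν * z.1)) z.2) ≤ 3 * D₁ ^ 2 :=
        h2.trans (mul_le_mul_of_nonneg_left (pow_le_pow_left₀ (norm_nonneg _) hD 2) (by norm_num))
      -- `|A|²_F ≤ 2|A - B|²_F + 2|B|²_F`
      have h := frobeniusNormSq_add_le (fderiv ℝ (v z.1) z.2 - fderiv ℝ (heatFlow v₀ (ν * z.1)) z.2)
        (fderiv ℝ (heatFlow v₀ (ν * z.1)) z.2)
      rw [sub_add_cancel] at h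
      calc ENNReal.ofReal (frobeniusNormSq (fderiv ℝ (v z.1) z.2))
          ≤ ENNReal.ofReal (2 * frobeniusNormSq (fderiv ℝ (v z.1) z.2 - fderiv ℝ (heatFlow v₀ (ν * z.1)) z.2) +
              6 * D₁ ^ 2) := ENNReal.ofReal_le_ofReal (by linarith)
        _ = _ := by
            rw [ENNReal.ofReal_add (mul_nonneg two_pos.le (frobeniusNormSq_nonneg _)) (by positivity),
              ENNReal.ofReal_mul two_pos.le, ENNReal.ofReal_ofNat]
    have hvol : volume (Ioo δ T ×ˢ ball (0 : ℝ³) ρ) < ∞ := by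
      rw [show (volume : Measure (ℝ × ℝ³)) = (volume : Measure ℝ).prod (volume : Measure ℝ³) from rfl,
        Measure.prod_prod]
      exact ENNReal.mul_lt_top measure_Ioo_lt_top measure_ball_lt_top
    calc ∫⁻ z in Ioo δ T ×ˢ ball (0 : ℝ³) ρ, ENNReal.ofReal (frobeniusNormSq (fderiv ℝ (v z.1) z.2))
        ≤ ∫⁻ z in Ioo δ T ×ˢ ball (0 : ℝ³) ρ,
            (2 * ENNReal.ofReal (frobeniusNormSq (fderiv ℝ (v z.1) z.2 - fderiv ℝ (heatFlow v₀ (ν * z.1)) z.2)) +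
              ENNReal.ofReal (6 * D₁ ^ 2)) :=
          setLIntegral_mono' (measurableSet_Ioo.prod measurableSet_ball) fun z hz => hpt z hz.1.1.le
      _ = 2 * (∫⁻ z in Ioo δ T ×ˢ ball (0 : ℝ³) ρ,
            ENNReal.ofReal (frobeniusNormSq (fderiv ℝ (v z.1) z.2 - fderiv ℝ (heatFlow v₀ (ν * z.1)) z.2))) +
            ENNReal.ofReal (6 * D₁ ^ 2) * volume (Ioo δ T ×ˢ ball (0 : ℝ³) ρ) := by
          rw [lintegral_add_right _ measurable_const, lintegral_const_mul' _ _ (by norm_num), setLIntegral_const]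
      _ ≤ 2 * ENNReal.ofReal (K / ν) + ENNReal.ofReal (6 * D₁ ^ 2) * volume (Ioo δ T ×ˢ ball (0 : ℝ³) ρ) :=
          add_le_add (mul_le_mul_right ((lintegral_mono_set (prod_mono (Ioo_subset_Ioo_left hδ.le)
            (subset_univ _))).trans hD) 2) le_rfl
      _ < ∞ := ENNReal.add_lt_top.2 ⟨ENNReal.mul_lt_top (by norm_num) ENNReal.ofReal_lt_top,
          ENNReal.mul_lt_top ENNReal.ofReal_lt_top hvol⟩

/-- A smooth Kato solution has BOUNDED slices at positive times: the essential bound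
`IsKatoSolutionOn.exists_ae_norm_le_of_pos` on `(s/2, (s+T)/2) × ℝ³` holds everywhere by continuity. -/
theorem exists_forall_norm_slice_le (hν : 0 < ν) (hu : IsKatoSolutionOn T ν u₀ u)
    (hsm : IsSmoothSpaceTimeOn (Ioo 0 T) u) {s : ℝ} (hs : s ∈ Ioo 0 T) :
    ∃ M : ℝ, 0 ≤ M ∧ ∀ x, ‖u s x‖ ≤ M := by
  obtain ⟨M, hM⟩ := hu.exists_ae_norm_le_of_pos hν (a := s / 2) (S := (s + T) / 2) (by linarith [hs.1]) (by linarith [hs.2])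
  have hcont : ContinuousOn (fun z : ℝ × ℝ³ => u z.1 z.2) (Ioo (s / 2) ((s + T) / 2) ×ˢ (univ : Set ℝ³)) :=
    hsm.continuousOn.mono (prod_mono (Ioo_subset_Ioo (by linarith [hs.1]) (by linarith [hs.2])) Subset.rfl)
  have hall := SereginSverak2009.forall_le_of_ae_le_of_continuousOn (isOpen_Ioo.prod isOpen_univ) hcont.norm
    continuousOn_const hM
  exact ⟨max M 0, le_max_right _ _, fun x => (hall (s, x) ⟨⟨by linarith [hs.1], by linarith [hs.2]⟩, mem_univ _⟩).trans
    (le_max_left _ _)⟩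

/-- The restart `t ↦ u(s + t)`, `0 ≤ s`, of a field smooth on `(0, T) × ℝ³` is smooth on `(0, T - s) × ℝ³`. -/
theorem isSmoothSpaceTimeOn_restart (hsm : IsSmoothSpaceTimeOn (Ioo 0 T) u) {s : ℝ} (hs : 0 ≤ s) :
    IsSmoothSpaceTimeOn (Ioo 0 (T - s)) (fun t => u (s + t)) := by
  have hφ : ContDiff ℝ ((⊤ : ℕ∞) : WithTop ℕ∞) (fun z : ℝ × ℝ³ => ((s + z.1, z.2) : ℝ × _)) :=
    (contDiff_const.add contDiff_fst).prodMk contDiff_snd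
  exact hsm.comp hφ.contDiffOn fun z hz => ⟨⟨by linarith [hz.1.1], by linarith [hz.1.2]⟩, mem_univ _⟩

end KatoNearTop

/-- **Stub K — `stub_katoLocalEnergyNearTop`: the local energy classes of a smooth axisymmetric
Kato solution reach the final time** (the Calderón / Rusin–Šverák splitting, Rusin–Šverák 2011
§4 p. 6; Lemarié-Rieusset 2016, Prop. 15.1 / Thm. 15.1). For `ν > 0`, `T > 0` and a Kato solution
`u` on `[0, T)`, smooth on `(0, T) × ℝ³` with axisymmetric slices, the normalised pressure
`p(t) = p̃[u(t)]` has axisymmetric slices, `(u, p)` is a suitable weak solution of the unforced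
equations on the open strip `(0, T) × ℝ³` (`KatoNearTop.suitable_normalisedPressure_strip`), and on
every `(t₁, T) × B_ρ(0)`, `0 < t₁ < T`: `sup_t ∫_{B_ρ}|u(t)|² < ∞`, `∫∫_{B_ρ}|∇u|² < ∞` (restart at the
bounded slice `u(t₁/2)`, `KatoNearTop.local_energy_bounds`, translated back in time) and
`∫∫_{B_ρ}|p|^{3/2} < ∞` (`KatoNearTop.lintegral_normalisedPressure_lt_top_of_bounded_slice`). -/
theorem stub_katoLocalEnergyNearTop :
    ∀ ν : ℝ, 0 < ν → ∀ T : ℝ, 0 < T → ∀ (u₀ : ℝ³ → ℝ³) (u : ℝ → ℝ³ → ℝ³),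
      IsKatoSolutionOn T ν u₀ u → ContDiffOn ℝ (⊤ : ℕ∞) (uncurry u) (Ioo 0 T ×ˢ univ) →
      (∀ t ∈ Ioo 0 T, IsAxisymmetric (u t)) →
      ∃ p : ℝ → ℝ³ → ℝ,
        (∀ t ∈ Ioo 0 T, IsAxisymmetricScalar (p t)) ∧
        IsSuitableWeakSolutionOn (slab ℝ³ (Ioo 0 T) isOpen_Ioo) ν 0 u p ∧
        ∀ t₁ ∈ Ioo 0 T, ∀ ρ : ℝ, 0 < ρ →
          (∃ C : ℝ≥0, ∀ t ∈ Ioo t₁ T, ∫⁻ x in ball (0 : ℝ³) ρ, ‖u t x‖ₑ ^ 2 ≤ C) ∧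
          (∫⁻ z in Ioo t₁ T ×ˢ ball (0 : ℝ³) ρ,
              ENNReal.ofReal (frobeniusNormSq (fderiv ℝ (u z.1) z.2)) < ∞) ∧
          (∫⁻ z in Ioo t₁ T ×ˢ ball (0 : ℝ³) ρ, ‖p z.1 z.2‖ₑ ^ (3 / 2 : ℝ) < ∞) := by
  intro ν hν T hT u₀ u hu hsm hax
  refine ⟨fun t => normalisedPressure (u t), fun t ht => (hax t ht).isAxisymmetricScalar_normalisedPressure,
    KatoNearTop.suitable_normalisedPressure_strip hν hu hT, fun t₁ ht₁ ρ _hρ => ?_⟩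
  -- restart at the bounded slice `u(s)`, `s = t₁/2`
  set s : ℝ := t₁ / 2 with hs_def
  have hs : s ∈ Ioo 0 T := ⟨by rw [hs_def]; linarith [ht₁.1], by rw [hs_def]; linarith [ht₁.1, ht₁.2]⟩
  have hst₁ : s < t₁ := by rw [hs_def]; linarith [ht₁.1]
  obtain ⟨M, hM0, hMb⟩ := KatoNearTop.exists_forall_norm_slice_le hν hu hsm hs
  have hv : IsKatoSolutionOn (T - s) ν (u s) (fun t => u (s + t)) := hu.restart hν ⟨hs.1.le, hs.2⟩
  obtain ⟨⟨C, hC⟩, hD⟩ := KatoNearTop.local_energy_bounds (ρ := ρ) hν hv (by linarith [hs.2]) hM0 hMb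
    (KatoNearTop.isSmoothSpaceTimeOn_restart hsm hs.1.le) (sub_pos.2 hst₁)
  refine ⟨⟨C, fun t ht => ?_⟩, ?_, ?_⟩
  · -- energy: `u(t) = ũ(t - s)`
    have h : ∫⁻ x in ball (0 : ℝ³) ρ, ‖u (s + (t - s)) x‖ₑ ^ 2 ≤ C :=
      hC (t - s) ⟨by linarith [ht.1], by linarith [ht.2]⟩
    rwa [add_sub_cancel] at h
  · -- dissipation: translate back in time
    rw [← setLIntegral_prod_timeShift s t₁ T (ball (0 : ℝ³) ρ)
      (fun z : ℝ × ℝ³ => ENNReal.ofReal (frobeniusNormSq (fderiv ℝ (u z.1) z.2)))]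
    exact hD
  · -- pressure: `∫_{t₁}^T∫_{B_ρ} |p|^{3/2} ≤ ∫_s^T∫ |p|^{3/2} < ∞`
    exact lt_of_le_of_lt (lintegral_mono_set (prod_mono (Ioo_subset_Ioo_left hst₁.le) (subset_univ _)))
      (KatoNearTop.lintegral_normalisedPressure_lt_top_of_bounded_slice hν hu hs hMb)

end Summit.NavierStokesRegularity.NavierStokesRegularity.Theorems.AxisymmetricKatoGlobal.Registered

end
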